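import Summits.ResolutionOfSingularities.ResolutionOfSingularities.Theorems.WeightedInvariantHypersurfaceLocalGameEFTPointMoveChart
import HarnessLib

/-!
# (iso-succ) bridge (BR3): the weighted initial form `in_w f` — its homogeneity, its coefficients, and the unit `ḡ₁^ν`-coefficient
# (door `HypersurfaceCentreConstruction`, stmt-ResolutionOfSingularities-19897; P3 rung `stub_keyRungLE_three`, skeleton v3.8; ORDER (o42),
# RULING gen 11 #6 (2) of res-L1-w43-plan-1: (BR3) + PART A′ → res-type-061, pair of res-type-073's PART C)

Topic: `Summits/ResolutionOfSingularities/ResolutionOfSingularities/Theorems`.  DEF-FREE.  The tree realises `B ⧸ (t⁻¹) ≃ (S ⧸ (u))[X₁,…,X_d]`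
(`LocalGameEFTPointMove.quotEquiv` / `rho`, res-type-098) and computes the image of the saturated transform of `f = Σ_{α ∈ Δ} a_α u^α + r`
(`r ∈ 𝔪^N`, `m ≤ w·α` on `Δ`, `m < N`) as the FACE POLYNOMIAL `rho (transform …) = Σ_{α ∈ Δ, w·α = m} ā_α X^α` (`rho_transform`).  This file
supplies what res-type-073's PART C reads off that polynomial (`in_w f`), as pure statements about the face sum
`Σ_{α ∈ Δ.filter (w·α = m)} C (c α) * ∏ i, X i ^ α i` and about the representation of `f`:

* `isWeightedHomogeneous_faceSum` — the face sum is weighted-homogeneous of degree `m` (any coefficient ring);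
* `coeff_faceSum` — its coefficient at `β` is `c β` if `β ∈ Δ` has weight `m`, else `0`;
* `exists_mem_degree_eq_and_not_mem` — ORDER COUNT: if `w i₀` is a top weight, `m = w i₀ · ν`, `N ≥ ν + 1` and `f ∉ 𝔪^{ν+1}` (`u i ∈ 𝔪`), then
  some `α ∈ Δ` of standard degree `ν` has `a_α ∉ 𝔪` (every `α` of weight `≥ w i₀ ν` has degree `≥ ν`, and those of degree `> ν` contribute to
  `𝔪^{ν+1}`); `single_mem_and_not_mem` — if `w i₀` is the STRICTLY largest weight, that `α` is `ν · e_{i₀}`: `ν e_{i₀} ∈ Δ` and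
  `a_{ν e_{i₀}} ∉ 𝔪`;
* **`coeff_single_faceSum_ne_zero`** — (BR3) proper: over `S ⧸ 𝔪` the face polynomial of degree `w i₀ · ν` has NON-ZERO coefficient at
  `X_{i₀}^ν` when `w i₀` is the strictly largest weight (the `r₁ > r₂` case of the σ-flag centre `u = (x, g₂, g₁)`, `w = (q, r₂, r₁)`, `i₀ = 2`);
  `exists_coeff_faceSum_ne_zero_of_degree_eq` — in general (top weight possibly attained twice, `r₁ = r₂`) some coefficient at a monomial
  of standard degree `ν` is non-zero (input of PART A′); `le_degree_of_mem_support_faceSum` — every monomial of the face polynomial has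
  standard degree `≥ ν`.

With res-type-073's PART B (`IsSigmaMaximiser.not_mem_succ_level`: the level is EXACTLY `r₁ν`) and res-type-070's bridge B1 these feed PART A
(`Iota3.eq_C_mul_pow_of_pow_dvd_fin3`, p533815: hypotheses `hF` = `isWeightedHomogeneous_faceSum`, `hFi` = `coeff_single_faceSum_ne_zero`).

[folklore commutative algebra; OUR bookkeeping for OUR (o42) lemma; nothing here is a statement about Hironaka's problem or of the manuscript
under review (Hironaka 2017, [claim: Hironaka2017, status: under-review]); AI formalisation, weaker than expert review.]
-/

open MvPolynomial

set_option linter.dupNamespace false -- mandated namespace of this single-conjunct summit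

namespace Summit.ResolutionOfSingularities.ResolutionOfSingularities.Cruxes.HypersurfaceCentreConstruction.LocalEngine

namespace Iota3

/-! ## The face sum as a polynomial -/

section FaceSum

variable {R : Type} [CommRing R] {d : ℕ}

/-- `C c · ∏ᵢ Xᵢ^{αᵢ}` is the monomial with exponent `α`. [folklore] -/
theorem C_mul_prod_X_pow_eq_monomial (c : R) (α : Fin d → ℕ) :
    C c * ∏ i, X i ^ α i = monomial (Finsupp.equivFunOnFinite.symm α) c := by
  rw [monomial_eq, Finsupp.prod_fintype _ _ (fun i => pow_zero _)]
  simp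

/-- The weight of a `Fin d`-function exponent. [folklore] -/
theorem weight_equivFunOnFinite_symm (w : Fin d → ℕ) (α : Fin d → ℕ) :
    Finsupp.weight w (Finsupp.equivFunOnFinite.symm α) = ∑ i, w i * α i := by
  rw [Finsupp.weight_apply, Finsupp.sum_fintype _ _ (fun i => by simp)]
  simp [smul_eq_mul, mul_comm]

/-- The standard degree of a `Fin d`-function exponent. [folklore] -/
theorem degree_equivFunOnFinite_symm (α : Fin d → ℕ) : (Finsupp.equivFunOnFinite.symm α).degree = ∑ i, α i := by
  rw [Finsupp.degree_eq_sum]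
  simp

/-- **The face sum is weighted-homogeneous of degree `m`.** [folklore] -/
theorem isWeightedHomogeneous_faceSum (w : Fin d → ℕ) (Δ : Finset (Fin d → ℕ)) (c : (Fin d → ℕ) → R) (m : ℕ) :
    (∑ α ∈ Δ.filter (fun α : Fin d → ℕ => ∑ i, w i * α i = m), C (c α) * ∏ i, X i ^ α i).IsWeightedHomogeneous w m := by
  classical
  refine IsWeightedHomogeneous.sum _ _ m fun α hα => ?_
  rw [Finset.mem_filter] at hα
  rw [C_mul_prod_X_pow_eq_monomial]
  exact isWeightedHomogeneous_monomial w _ _ (by rw [weight_equivFunOnFinite_symm]; exact hα.2)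

/-- **Coefficients of the face sum**: `c β` at an exponent `β ∈ Δ` of weight `m`, zero elsewhere. [folklore] -/
theorem coeff_faceSum (w : Fin d → ℕ) (Δ : Finset (Fin d → ℕ)) (c : (Fin d → ℕ) → R) (m : ℕ) (β : Fin d →₀ ℕ) :
    coeff β (∑ α ∈ Δ.filter (fun α : Fin d → ℕ => ∑ i, w i * α i = m), C (c α) * ∏ i, X i ^ α i) =
      if (⇑β ∈ Δ ∧ ∑ i, w i * β i = m) then c β else 0 := by
  classical
  simp_rw [C_mul_prod_X_pow_eq_monomial, coeff_sum, coeff_monomial]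
  have key : ∀ α : Fin d → ℕ, (Finsupp.equivFunOnFinite.symm α = β) = (α = ⇑β) := fun α => by
    rw [Equiv.symm_apply_eq]
    rfl
  simp_rw [key, Finset.sum_ite_eq', Finset.mem_filter]

/-- Every exponent of the face sum lies in `Δ` and has weight `m`. [folklore] -/
theorem mem_and_weight_eq_of_mem_support_faceSum (w : Fin d → ℕ) (Δ : Finset (Fin d → ℕ)) (c : (Fin d → ℕ) → R) (m : ℕ)
    {β : Fin d →₀ ℕ} (hβ : β ∈ (∑ α ∈ Δ.filter (fun α : Fin d → ℕ => ∑ i, w i * α i = m), C (c α) * ∏ i, X i ^ α i).support) :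
    ⇑β ∈ Δ ∧ ∑ i, w i * β i = m := by
  rw [mem_support_iff, coeff_faceSum] at hβ
  by_contra h
  exact hβ (if_neg h)

end FaceSum

/-! ## Weight and degree counts -/

section Counts

variable {d : ℕ}

/-- If `w i₀` is a top weight and `w i₀ · ν ≤ w·α` then `ν ≤ |α|`. [folklore] -/
theorem le_degree_of_le_weight (w : Fin d → ℕ) (i₀ : Fin d) (hwi : ∀ j, w j ≤ w i₀) (hw₀ : 0 < w i₀) {ν : ℕ} {α : Fin d → ℕ}
    (h : w i₀ * ν ≤ ∑ i, w i * α i) : ν ≤ ∑ i, α i := by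
  have h1 : ∑ i, w i * α i ≤ ∑ i, w i₀ * α i := Finset.sum_le_sum fun i _ => Nat.mul_le_mul_right _ (hwi i)
  rw [← Finset.mul_sum] at h1
  exact Nat.le_of_mul_le_mul_left (h.trans h1) hw₀

/-- If `w i₀` is the STRICTLY largest weight, `w i₀ · ν ≤ w·α` and `α ≠ ν e_{i₀}`, then `ν + 1 ≤ |α|`. [folklore] -/
theorem succ_le_degree_of_le_weight_of_ne_single (w : Fin d → ℕ) (i₀ : Fin d) (hwi : ∀ j, j ≠ i₀ → w j < w i₀) (hw₀ : 0 < w i₀)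
    {ν : ℕ} {α : Fin d → ℕ} (h : w i₀ * ν ≤ ∑ i, w i * α i) (hne : α ≠ Pi.single i₀ ν) : ν + 1 ≤ ∑ i, α i := by
  have hwi' : ∀ j, w j ≤ w i₀ := fun j => by
    by_cases hj : j = i₀
    · rw [hj]
    · exact (hwi j hj).le
  have hle := le_degree_of_le_weight w i₀ hwi' hw₀ h
  by_contra hlt
  have heq : ∑ i, α i = ν := by omega
  have h1 : ∀ i ∈ (Finset.univ : Finset (Fin d)), w i * α i ≤ w i₀ * α i := fun i _ => Nat.mul_le_mul_right _ (hwi' i)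
  have h2 : ∑ i, w i₀ * α i ≤ ∑ i, w i * α i := by rw [← Finset.mul_sum, heq]; exact h
  have h3 : ∑ i, w i * α i = ∑ i, w i₀ * α i := le_antisymm (Finset.sum_le_sum h1) h2
  rw [Finset.sum_eq_sum_iff_of_le h1] at h3
  apply hne
  funext j
  by_cases hj : j = i₀
  · subst hj
    rw [Pi.single_eq_same, ← heq]
    symm
    refine Finset.sum_eq_single_of_mem j (Finset.mem_univ j) fun i _ hi => ?_
    have h4 := h3 i (Finset.mem_univ i)
    by_contra hαi
    exact absurd (Nat.eq_of_mul_eq_mul_right (Nat.pos_of_ne_zero hαi) h4) (hwi i hi).ne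
  · rw [Pi.single_eq_of_ne hj]
    have h4 := h3 j (Finset.mem_univ j)
    by_contra hαj
    exact absurd (Nat.eq_of_mul_eq_mul_right (Nat.pos_of_ne_zero hαj) h4) (hwi j hj).ne

end Counts

/-! ## The order count: which coefficients of the representation are units -/

section Order

variable {S : Type} [CommRing S] {d : ℕ}

/-- `∏ᵢ uᵢ^{αᵢ} ∈ 𝔪^{|α|}` when every `uᵢ ∈ 𝔪`. [folklore] -/
theorem prod_pow_mem_pow_sum (𝔪 : Ideal S) (u : Fin d → S) (hu : ∀ i, u i ∈ 𝔪) (α : Fin d → ℕ) :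
    ∏ i, u i ^ α i ∈ 𝔪 ^ (∑ i, α i) := by
  rw [← Finset.prod_pow_eq_pow_sum]
  exact Ideal.prod_mem_prod fun i _ => Ideal.pow_mem_pow (hu i) _

/-- **ORDER COUNT.**  `uᵢ ∈ 𝔪`, `w i₀` a top weight, `f = Σ_{α ∈ Δ} a_α u^α + r` with `r ∈ 𝔪^N`, `N ≥ ν + 1`, every `α ∈ Δ` of weight
`≥ w i₀ · ν`, and `f ∉ 𝔪^{ν+1}`: then some `α ∈ Δ` of standard degree `ν` has `a_α ∉ 𝔪`. [folklore] -/
theorem exists_mem_degree_eq_and_not_mem (𝔪 : Ideal S) (u : Fin d → S) (hu : ∀ i, u i ∈ 𝔪) (w : Fin d → ℕ) (i₀ : Fin d)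
    (hwi : ∀ j, w j ≤ w i₀) (hw₀ : 0 < w i₀) {ν N : ℕ} (hN : ν + 1 ≤ N) (Δ : Finset (Fin d → ℕ)) (a : (Fin d → ℕ) → S)
    (hΔ : ∀ α ∈ Δ, w i₀ * ν ≤ ∑ i, w i * α i) {r : S} (hr : r ∈ 𝔪 ^ N) {f : S}
    (hf : f = ∑ α ∈ Δ, a α * ∏ i, u i ^ α i + r) (hford : f ∉ 𝔪 ^ (ν + 1)) :
    ∃ α ∈ Δ, ∑ i, α i = ν ∧ a α ∉ 𝔪 := by
  by_contra hcon
  push Not at hcon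
  apply hford
  rw [hf]
  refine Ideal.add_mem _ (Ideal.sum_mem _ fun α hα => ?_) (Ideal.pow_le_pow_right hN hr)
  have hdeg := le_degree_of_le_weight w i₀ hwi hw₀ (hΔ α hα)
  have hprod := prod_pow_mem_pow_sum 𝔪 u hu α
  rcases hdeg.eq_or_lt with heq | hlt
  · rw [pow_succ']
    refine Ideal.mul_mem_mul (hcon α hα heq.symm) ?_
    rw [heq]
    exact hprod
  · exact Ideal.mul_mem_left _ _ (Ideal.pow_le_pow_right hlt hprod)

/-- **ORDER COUNT, strictly largest weight**: then `ν e_{i₀} ∈ Δ` and `a_{ν e_{i₀}} ∉ 𝔪`. [folklore] -/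
theorem single_mem_and_not_mem (𝔪 : Ideal S) (u : Fin d → S) (hu : ∀ i, u i ∈ 𝔪) (w : Fin d → ℕ) (i₀ : Fin d)
    (hwi : ∀ j, j ≠ i₀ → w j < w i₀) (hw₀ : 0 < w i₀) {ν N : ℕ} (hN : ν + 1 ≤ N) (Δ : Finset (Fin d → ℕ)) (a : (Fin d → ℕ) → S)
    (hΔ : ∀ α ∈ Δ, w i₀ * ν ≤ ∑ i, w i * α i) {r : S} (hr : r ∈ 𝔪 ^ N) {f : S}
    (hf : f = ∑ α ∈ Δ, a α * ∏ i, u i ^ α i + r) (hford : f ∉ 𝔪 ^ (ν + 1)) :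
    Pi.single i₀ ν ∈ Δ ∧ a (Pi.single i₀ ν) ∉ 𝔪 := by
  have hwi' : ∀ j, w j ≤ w i₀ := fun j => by
    by_cases hj : j = i₀
    · rw [hj]
    · exact (hwi j hj).le
  obtain ⟨α, hα, hdeg, ha⟩ := exists_mem_degree_eq_and_not_mem 𝔪 u hu w i₀ hwi' hw₀ hN Δ a hΔ hr hf hford
  have hαe : α = Pi.single i₀ ν := by
    by_contra hne
    have h1 := succ_le_degree_of_le_weight_of_ne_single w i₀ hwi hw₀ (hΔ α hα) hne
    omega
  subst hαe
  exact ⟨hα, ha⟩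

/-- The weight of `ν e_{i₀}` read as a `Finsupp`. [folklore] -/
theorem sum_mul_single_apply (w : Fin d → ℕ) (i₀ : Fin d) (ν : ℕ) :
    ∑ i, w i * (Finsupp.single i₀ ν : Fin d →₀ ℕ) i = w i₀ * ν := by
  rw [Finset.sum_eq_single_of_mem i₀ (Finset.mem_univ _) fun j _ hj => by rw [Finsupp.single_eq_of_ne hj, mul_zero]]
  rw [Finsupp.single_eq_same]

/-- **(BR3) — the `X_{i₀}^ν`-coefficient of the weighted initial form is NON-ZERO** (strictly largest weight `w i₀`; the `r₁ > r₂` case of the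
σ-flag centre `u = (x, g₂, g₁)`, `w = (q, r₂, r₁)`, `i₀ = 2`): for `f = Σ_{α ∈ Δ} a_α u^α + r` as in `LocalGameEFTPointMove.transform` with
`m = w i₀ · ν`, `N ≥ ν + 1`, `uᵢ ∈ 𝔪` and `f ∉ 𝔪^{ν+1}` (`ord f = ν`), the face polynomial over `S ⧸ 𝔪` has non-zero coefficient at `X_{i₀}^ν`.
[folklore · OUR (o42) bookkeeping] -/
theorem coeff_single_faceSum_ne_zero (𝔪 : Ideal S) (u : Fin d → S) (hu : ∀ i, u i ∈ 𝔪) (w : Fin d → ℕ) (i₀ : Fin d)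
    (hwi : ∀ j, j ≠ i₀ → w j < w i₀) (hw₀ : 0 < w i₀) {ν N : ℕ} (hN : ν + 1 ≤ N) (Δ : Finset (Fin d → ℕ)) (a : (Fin d → ℕ) → S)
    (hΔ : ∀ α ∈ Δ, w i₀ * ν ≤ ∑ i, w i * α i) {r : S} (hr : r ∈ 𝔪 ^ N) {f : S}
    (hf : f = ∑ α ∈ Δ, a α * ∏ i, u i ^ α i + r) (hford : f ∉ 𝔪 ^ (ν + 1)) :
    coeff (Finsupp.single i₀ ν)
      (∑ α ∈ Δ.filter (fun α : Fin d → ℕ => ∑ i, w i * α i = w i₀ * ν),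
        C (Ideal.Quotient.mk 𝔪 (a α)) * ∏ i, (X i : MvPolynomial (Fin d) (S ⧸ 𝔪)) ^ α i) ≠ 0 := by
  classical
  obtain ⟨hmem, ha⟩ := single_mem_and_not_mem 𝔪 u hu w i₀ hwi hw₀ hN Δ a hΔ hr hf hford
  have hwt : ∑ i, w i * (Finsupp.single i₀ ν : Fin d →₀ ℕ) i = w i₀ * ν := sum_mul_single_apply w i₀ ν
  have hmem' : ⇑(Finsupp.single i₀ ν : Fin d →₀ ℕ) ∈ Δ := by rwa [Finsupp.single_eq_pi_single]
  rw [coeff_faceSum, if_pos ⟨hmem', hwt⟩, Finsupp.single_eq_pi_single, Ne, Ideal.Quotient.eq_zero_iff_mem]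
  exact ha

/-- **(BR3), equal top weights allowed** (the `r₁ = r₂` reading, input of PART A′): some coefficient of the face polynomial over `S ⧸ 𝔪` at a
monomial of standard degree `ν` is non-zero. [folklore · OUR (o42) bookkeeping] -/
theorem exists_coeff_faceSum_ne_zero_of_degree_eq (𝔪 : Ideal S) (u : Fin d → S) (hu : ∀ i, u i ∈ 𝔪) (w : Fin d → ℕ) (i₀ : Fin d)
    (hwi : ∀ j, w j ≤ w i₀) (hw₀ : 0 < w i₀) {ν N : ℕ} (hN : ν + 1 ≤ N) (Δ : Finset (Fin d → ℕ)) (a : (Fin d → ℕ) → S)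
    (hΔ : ∀ α ∈ Δ, w i₀ * ν ≤ ∑ i, w i * α i) {r : S} (hr : r ∈ 𝔪 ^ N) {f : S}
    (hf : f = ∑ α ∈ Δ, a α * ∏ i, u i ^ α i + r) (hford : f ∉ 𝔪 ^ (ν + 1)) :
    ∃ β : Fin d →₀ ℕ, β.degree = ν ∧
      coeff β (∑ α ∈ Δ.filter (fun α : Fin d → ℕ => ∑ i, w i * α i = w i₀ * ν),
        C (Ideal.Quotient.mk 𝔪 (a α)) * ∏ i, (X i : MvPolynomial (Fin d) (S ⧸ 𝔪)) ^ α i) ≠ 0 := by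
  classical
  obtain ⟨α, hα, hdeg, ha⟩ := exists_mem_degree_eq_and_not_mem 𝔪 u hu w i₀ hwi hw₀ hN Δ a hΔ hr hf hford
  refine ⟨Finsupp.equivFunOnFinite.symm α, by rw [degree_equivFunOnFinite_symm, hdeg], ?_⟩
  have hw : ∑ i, w i * α i = w i₀ * ν := by
    refine le_antisymm ?_ (hΔ α hα)
    calc ∑ i, w i * α i ≤ ∑ i, w i₀ * α i := Finset.sum_le_sum fun i _ => Nat.mul_le_mul_right _ (hwi i)
      _ = w i₀ * ν := by rw [← Finset.mul_sum, hdeg]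
  rw [coeff_faceSum, Finsupp.coe_equivFunOnFinite_symm, if_pos ⟨hα, hw⟩]
  rwa [Ne, Ideal.Quotient.eq_zero_iff_mem]

/-- Every monomial of the face polynomial of degree `w i₀ · ν` (`w i₀` a top weight) has standard degree `≥ ν`. [folklore] -/
theorem le_degree_of_mem_support_faceSum {R : Type} [CommRing R] (w : Fin d → ℕ) (i₀ : Fin d) (hwi : ∀ j, w j ≤ w i₀) (hw₀ : 0 < w i₀)
    (ν : ℕ) (Δ : Finset (Fin d → ℕ)) (c : (Fin d → ℕ) → R) {β : Fin d →₀ ℕ}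
    (hβ : β ∈ (∑ α ∈ Δ.filter (fun α : Fin d → ℕ => ∑ i, w i * α i = w i₀ * ν), C (c α) * ∏ i, X i ^ α i).support) :
    ν ≤ β.degree := by
  obtain ⟨-, hw⟩ := mem_and_weight_eq_of_mem_support_faceSum w Δ c (w i₀ * ν) hβ
  have h := le_degree_of_le_weight w i₀ hwi hw₀ (α := ⇑β) hw.ge
  rwa [← degree_equivFunOnFinite_symm, Finsupp.equivFunOnFinite_symm_coe] at h

end Order

/-! ## The σ-flag centre: `d = 3`, `u = (x, g₂, g₁)`, `w = (q, r₂, r₁)`, `i₀ = 2` -/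

section Fin3

variable {S : Type} [CommRing S]

/-- Positive weights `0 < q ≤ r₂ ≤ r₁`, componentwise. [folklore] -/
theorem vec3_pos {q r₂ r₁ : ℕ} (hq : 0 < q) (hq₂ : q ≤ r₂) (h₂₁ : r₂ ≤ r₁) (j : Fin 3) : 0 < (![q, r₂, r₁] : Fin 3 → ℕ) j := by
  fin_cases j
  · exact hq
  · exact lt_of_lt_of_le hq hq₂
  · exact lt_of_lt_of_le hq (hq₂.trans h₂₁)

/-- `r₁` is a top weight of `(q, r₂, r₁)` when `q ≤ r₂ ≤ r₁`. [folklore] -/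
theorem vec3_le_two {q r₂ r₁ : ℕ} (hq₂ : q ≤ r₂) (h₂₁ : r₂ ≤ r₁) (j : Fin 3) :
    (![q, r₂, r₁] : Fin 3 → ℕ) j ≤ (![q, r₂, r₁] : Fin 3 → ℕ) 2 := by
  fin_cases j
  · exact hq₂.trans h₂₁
  · exact h₂₁
  · exact le_rfl

/-- `r₁` is the STRICTLY largest weight of `(q, r₂, r₁)` when `q ≤ r₂ < r₁`. [folklore] -/
theorem vec3_lt_two {q r₂ r₁ : ℕ} (hq₂ : q ≤ r₂) (h₂₁ : r₂ < r₁) (j : Fin 3) (hj : j ≠ 2) :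
    (![q, r₂, r₁] : Fin 3 → ℕ) j < (![q, r₂, r₁] : Fin 3 → ℕ) 2 := by
  fin_cases j
  · exact lt_of_le_of_lt hq₂ h₂₁
  · exact h₂₁
  · exact absurd rfl hj

/-- **(BR3) for the σ-flag centre, `r₂ < r₁`**: `u = (x, g₂, g₁)` in `𝔪`, `f = Σ_{α ∈ Δ} a_α u^α + r` with every `α ∈ Δ` of weight
`≥ r₁ν` for `w = (q, r₂, r₁)` (`0 < q ≤ r₂ < r₁`), `r ∈ 𝔪^N`, `N ≥ ν + 1`, `f ∉ 𝔪^{ν+1}`: the face polynomial of degree `r₁ν` over `S ⧸ 𝔪` has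
NON-ZERO coefficient at `ḡ₁^ν = X 2 ^ ν` — hypothesis `hFi` of PART A `eq_C_mul_pow_of_pow_dvd_fin3`. [folklore · OUR (o42) bookkeeping] -/
theorem coeff_single_two_faceSum_ne_zero (𝔪 : Ideal S) (u : Fin 3 → S) (hu : ∀ i, u i ∈ 𝔪) {q r₂ r₁ : ℕ} (hq : 0 < q)
    (hq₂ : q ≤ r₂) (h₂₁ : r₂ < r₁) {ν N : ℕ} (hN : ν + 1 ≤ N) (Δ : Finset (Fin 3 → ℕ)) (a : (Fin 3 → ℕ) → S)
    (hΔ : ∀ α ∈ Δ, r₁ * ν ≤ ∑ i, (![q, r₂, r₁] : Fin 3 → ℕ) i * α i) {r : S} (hr : r ∈ 𝔪 ^ N) {f : S}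
    (hf : f = ∑ α ∈ Δ, a α * ∏ i, u i ^ α i + r) (hford : f ∉ 𝔪 ^ (ν + 1)) :
    coeff (Finsupp.single 2 ν)
      (∑ α ∈ Δ.filter (fun α : Fin 3 → ℕ => ∑ i, (![q, r₂, r₁] : Fin 3 → ℕ) i * α i = r₁ * ν),
        C (Ideal.Quotient.mk 𝔪 (a α)) * ∏ i, (X i : MvPolynomial (Fin 3) (S ⧸ 𝔪)) ^ α i) ≠ 0 :=
  coeff_single_faceSum_ne_zero 𝔪 u hu ![q, r₂, r₁] 2 (vec3_lt_two hq₂ h₂₁) (lt_of_lt_of_le hq (hq₂.trans h₂₁.le)) hN Δ a hΔ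
    hr hf hford

/-- **The face polynomial of the σ-flag centre is weighted-homogeneous of degree `r₁ν`** — hypothesis `hF` of PART A
`eq_C_mul_pow_of_pow_dvd_fin3`. [folklore] -/
theorem isWeightedHomogeneous_faceSum_fin3 {R : Type} [CommRing R] (q r₂ r₁ ν : ℕ) (Δ : Finset (Fin 3 → ℕ)) (c : (Fin 3 → ℕ) → R) :
    (∑ α ∈ Δ.filter (fun α : Fin 3 → ℕ => ∑ i, (![q, r₂, r₁] : Fin 3 → ℕ) i * α i = r₁ * ν), C (c α) * ∏ i, X i ^ α i).IsWeightedHomogeneous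
      ![q, r₂, r₁] (r₁ * ν) :=
  isWeightedHomogeneous_faceSum ![q, r₂, r₁] Δ c (r₁ * ν)

/-- **(BR3) for the σ-flag centre, `r₂ ≤ r₁`** (equal top weights allowed — the input of PART A′): some coefficient at a monomial of standard
degree `ν` is non-zero, and every monomial has standard degree `≥ ν`. [folklore · OUR (o42) bookkeeping] -/
theorem exists_coeff_faceSum_ne_zero_of_degree_eq_fin3 (𝔪 : Ideal S) (u : Fin 3 → S) (hu : ∀ i, u i ∈ 𝔪) {q r₂ r₁ : ℕ} (hq : 0 < q)
    (hq₂ : q ≤ r₂) (h₂₁ : r₂ ≤ r₁) {ν N : ℕ} (hN : ν + 1 ≤ N) (Δ : Finset (Fin 3 → ℕ)) (a : (Fin 3 → ℕ) → S)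
    (hΔ : ∀ α ∈ Δ, r₁ * ν ≤ ∑ i, (![q, r₂, r₁] : Fin 3 → ℕ) i * α i) {r : S} (hr : r ∈ 𝔪 ^ N) {f : S}
    (hf : f = ∑ α ∈ Δ, a α * ∏ i, u i ^ α i + r) (hford : f ∉ 𝔪 ^ (ν + 1)) :
    (∃ β : Fin 3 →₀ ℕ, β.degree = ν ∧
      coeff β (∑ α ∈ Δ.filter (fun α : Fin 3 → ℕ => ∑ i, (![q, r₂, r₁] : Fin 3 → ℕ) i * α i = r₁ * ν),
        C (Ideal.Quotient.mk 𝔪 (a α)) * ∏ i, (X i : MvPolynomial (Fin 3) (S ⧸ 𝔪)) ^ α i) ≠ 0) ∧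
    ∀ β ∈ (∑ α ∈ Δ.filter (fun α : Fin 3 → ℕ => ∑ i, (![q, r₂, r₁] : Fin 3 → ℕ) i * α i = r₁ * ν),
        C (Ideal.Quotient.mk 𝔪 (a α)) * ∏ i, (X i : MvPolynomial (Fin 3) (S ⧸ 𝔪)) ^ α i).support, ν ≤ β.degree :=
  ⟨exists_coeff_faceSum_ne_zero_of_degree_eq 𝔪 u hu ![q, r₂, r₁] 2 (vec3_le_two hq₂ h₂₁) (lt_of_lt_of_le hq (hq₂.trans h₂₁)) hN Δ a
      hΔ hr hf hford,
    fun _ hβ => le_degree_of_mem_support_faceSum ![q, r₂, r₁] 2 (vec3_le_two hq₂ h₂₁) (lt_of_lt_of_le hq (hq₂.trans h₂₁)) ν Δ _ hβ⟩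

end Fin3

end Iota3

end Summit.ResolutionOfSingularities.ResolutionOfSingularities.Cruxes.HypersurfaceCentreConstruction.LocalEngine
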